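import Summits.CriticalPhenomena.PercolationContinuityZ3.Theorems.Transplant.SkelPhiConcReachCorrR
import Summits.CriticalPhenomena.PercolationContinuityZ3.Theorems.Transplant.SkelSign2ParamsCorr
import Summits.CriticalPhenomena.PercolationContinuityZ3.Theorems.Transplant.SkelSignChoiceAll
import HarnessLib

/-!
# D″ node, OPTION C (multi-type), residue (C): `PlanarSkeletonSign.reachHoldsRHFnAll_signChoiceAll : ReachHoldsRHFnAll signChoiceAll`
# — the CORRIDOR RESIDUE of the multi-type closure `samePDropOfSkeletonSign_of_choiceFnAll signChoiceAll wfHoldsFnAll_signChoiceAll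
# rootHoldsFnAll_… faceHoldsRFnAll_… reachHoldsRHFnAll_…` (p3-g7 `SkelSignChoiceRef` p254929 / `SkelSignChoiceAll` p256257), i.e. the single-type
# (C) wrapper `reachHoldsRHFn_signChoice₂` (`SkelPhiConcReachHolds`, p5-g6 text) with the binder `Φ.types = {t}` DROPPED: the only place that
# binder was used is the Step-I′ certificate at `q`, which the residue `Skelφ.reachOblRH_of_stepI_corrR` (`SkelPhiConcReachCorrR`, p254079) wants
# over `StepI.index Φ.types (Sz O) (Sx O) (Sy O)` — exactly the family the all-types premise `AtQAll O q` carries (read at threshold `1 − κ.δ²`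
# through `Skelφ.Prm.inputs_mono ∘ δI_le_sq_of_le`, `Sgn.δkit ≤ κ.δ`); every other number / radius / count / kit / room fact is stmt-g9's `Sgn₂.*`
# dictionary (`SkelSign2ParamsAtQ/AtQ2/Depth/Counts/Widths/Corr`) read through `AtQAll.atQ ht : AtQ O q`.  Same instantiation as
# `SkelPhiConcReachHolds` (corridor schedules `Corr.CorrROK` per axis with rooms `corr_rooms₁_at/corr_rooms₂_at`, merged-range route facts,
# depth budget `r₀ + 3 ≤ L′`, kit block `Skelφ.Prm`, counts over the level window, excess at planar diameter `50·rmax`)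

builds on p205010 (kernel theorem, internal audit signed; external expert review pending) — nothing in this file uses p205010.
Lane `prim-bschramm`, seat `prim-bschramm-p5` (gen 7; (C) = p5 lineage under D″; option C second closing per the lead's node-level ruling
2026-08-21T07:20:22Z — this file closes nothing by itself and is filed only after the single-type audit); helper file
(`--supports stmt-CriticalPhenomena-4575 --as helper`).
* **`PlanarSkeletonSign.reachHoldsRHFnAll_signChoiceAll`** — the (C) argument of `samePDropOfSkeletonSign_of_choiceFnAll signChoiceAll …`.
[cite: KozmaNitzan2024, §4 Lemma 12 (pp. 23–25), p. 30 (Step IV), p. 31]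
-/

noncomputable section

open scoped Classical

namespace Summit.CriticalPhenomena.PercolationContinuityZ3.Theorems.Transplant

namespace PlanarSkeletonSign

open MeasureTheory
open Literature.Probability.Percolation Literature.Probability.LatticeModels SimpleGraph
open Literature.Probability.Percolation.KozmaNitzan.Cells (oth oth_oth)
open SkelConc (Consts)
open ChainPlanar KNCells

/-- **THE CORRIDOR RESIDUE OF THE MULTI-TYPE D″ NODE** ((C), KN §4 Lemma 12, ALL TYPES): `ReachHoldsRHFnAll signChoiceAll` — for every handed
constants `κ`, every admissible centred sign skeleton (ANY finite set of base types) and every running density with `AtQAll`, the run-restricted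
habitat corridor obligations `Skel.ReachOblRH` of the chosen scheme hold at accuracy `κ.δ`; the premise `AtQAll O q` carries the Step-I′ family over
`StepI.index Φ.types …`, which is exactly what `Skelφ.reachOblRH_of_stepI_corrR` consumes; every other fact is read through `AtQAll.atQ`.
[cite: KozmaNitzan2024, §4 Lemma 12 (pp. 23–25), p. 30 (Step IV), p. 31] -/
theorem reachHoldsRHFnAll_signChoiceAll : ReachHoldsRHFnAll signChoiceAll := by
  intro κ V _ _ G _ Φ hg t ht h0 p hp0 hp1 hC
  rw [signChoiceAll_eq]
  intro O q hatA
  have hat : (Sgn₂.choiceAt κ Φ t p hC).AtQ O q := hatA.atQ ht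
  -- the chosen scheme is the two-unit scheme of record over `Sgn₂.cells` with the radii `concRadii2S cells gap 0 E₀ L′` (all by `rfl`)
  show Skel.ReachOblRH G
    (⟨Skelφ.cellGeomSG G Φ.φ (Sgn₂.cells κ Φ p O) t (Skelφ.concRadii2S (Sgn₂.cells κ Φ p O) (Skelφ.Prm.gap (Sgn₂.schedIn κ Φ p O q))
      (fun _ => 0) (Skelφ.Prm.E₀ (Sgn₂.schedIn κ Φ p O q)) (Skelφ.Prm.Lp (Sgn₂.schedIn κ Φ p O q))), q, κ.δ⟩ : KSchA V ℕ)
    (Skelφ.faceDataSG G Φ.φ (Sgn₂.cells κ Φ p O) t (Skelφ.concRadii2S (Sgn₂.cells κ Φ p O) (Skelφ.Prm.gap (Sgn₂.schedIn κ Φ p O q))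
      (fun _ => 0) (Skelφ.Prm.E₀ (Sgn₂.schedIn κ Φ p O q)) (Skelφ.Prm.Lp (Sgn₂.schedIn κ Φ p O q)))) Φ.Δ κ.δ
  -- the dictionary of the sign skeleton
  have hlip : Skelφ.Lip G Φ.φ := Φ.toPlanarSkeletonNeg.lip_skelφ
  have hstep : Skelφ.Steps G Φ.φ := Φ.toPlanarSkeletonNeg.steps_skelφ
  have hκ : Skelφ.CylConn G Φ.φ Φ.types := Φ.toPlanarSkeletonNeg.cylConn_skelφ
  -- the Step-I′ family at `q` with threshold `1 − κ.δ²`, over the lists of record and ALL types (6th conjunct of `AtQAll`, at `1 − δI`)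
  have hδk : Sgn.δkit κ Φ ≤ κ.δ := (Sgn₂.δkit_facts κ Φ).2.2.1
  have hfam : ∀ i ∈ Skelφ.StepI.index Φ.types (Sgn.Sz O) (Sgn₂.Sx κ Φ p O) (Sgn₂.Sy κ Φ p O),
      1 - κ.δ ^ 2 < (bondPercolation G q).real (Skelφ.StepI.event G Φ.φ O.D i) :=
    fun i hi => Skelφ.Prm.inputs_mono (Skelφ.Prm.δI_le_sq_of_le G Φ.degree_le κ (Sgn.A κ) hδk) (hatA.2.2.2.2.2.1 i hi)
  -- the kit scale and the level window
  obtain ⟨-, -, hR', -⟩ := Sgn₂.kit_scale_at (κ := κ) (Φ := Φ) (p := p) (O := O)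
  obtain ⟨hcard, hj₁⟩ := Sgn₂.levels_card (κ := κ) (Φ := Φ) (O := O) hp0 hp1
  obtain ⟨hkP, hcnt⟩ := Sgn₂.counts_at_le hat hp0 hp1 hδk
  obtain ⟨hNP, -⟩ := Sgn₂.hN (κ := κ) (Φ := Φ) (O := O) hp0 hp1
  obtain ⟨hr₀₁, hr₀₂, -⟩ := Sgn₂.r₀_kit_at (κ := κ) (Φ := Φ) (p := p) (O := O)
  have hRΛ := Sgn₂.R_Λ_eq hat
  refine Skelφ.reachOblRH_of_stepI_corrR (types := Φ.types) hlip hstep Φ.frame hκ Φ.degree_le hC (D := O.D) (off := O.off) hRΛ.2 q κ.hδ0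
    hfam (Sgn₂.cells κ Φ p O) t (Skelφ.Prm.gap (Sgn₂.schedIn κ Φ p O q)) (fun _ => 0) (Skelφ.Prm.E₀ (Sgn₂.schedIn κ Φ p O q))
    (Skelφ.Prm.Lp (Sgn₂.schedIn κ Φ p O q)) κ.δ (R' := Sgn.R' κ Φ p O) (Rlev := Sgn.Rlev κ Φ p O) (N := Sgn.NP κ Φ p O) (j₀ := Sgn.T₀ O)
    (j₁ := Sgn.T₀ O + Sgn.Lcnt κ Φ p O - 1) (le_of_eq hR'.symm) hj₁ Sgn₂.WFS2_at h0 (fun n => (Sgn₂.fibre_at (κ := κ) (Φ := Φ) (p := p) (O := O) (q := q) n 0).2.2.1) ?_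
    (fun ρ => (Sgn₂.fibre_at (κ := κ) (Φ := Φ) (p := p) (O := O) (q := q) ρ 0).2.1)
    -- the corridor schedules per axis
    (fun a => ⟨Sgn₂.corr_loc₁_at hat a, Sgn₂.corr_loc₂_at hat a, Sgn₂.corr_band_at hat a, Sgn₂.corr_hℓ₁₃_at hat a,
      (Sgn₂.corr_joins_at (κ := κ) (Φ := Φ) (p := p) (O := O) a).1, (Sgn₂.corr_joins_at (κ := κ) (Φ := Φ) (p := p) (O := O) a).2.1,
      (Sgn₂.corr_joins_at (κ := κ) (Φ := Φ) (p := p) (O := O) a).2.2.1, (Sgn₂.corr_joins_at (κ := κ) (Φ := Φ) (p := p) (O := O) a).2.2.2⟩)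
    (fun a => (Sgn₂.corr_rooms₁_at hat a).1) (fun a => (Sgn₂.corr_rooms₁_at hat a).2.1)
    (fun a => (Sgn₂.corr_rooms₂_at hat a).1) (fun a => (Sgn₂.corr_rooms₂_at hat a).2.1) (fun a => (Sgn₂.corr_rooms₂_at hat a).2.2.1)
    (fun a => (Sgn₂.corr_rooms₂_at hat a).2.2.2.1) (fun a => (Sgn₂.corr_rooms₁_at hat a).2.2.1) (fun a => (Sgn₂.corr_rooms₂_at hat a).2.2.2.2.1)
    (fun a => (Sgn₂.corr_rooms₁_at hat a).2.2.2.2) (fun a => (Sgn₂.corr_rooms₁_at hat a).2.2.2.1) (fun a => (Sgn₂.corr_rooms₂_at hat a).2.2.2.2.2)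
    (fun a => Sgn₂.corridor_length_le hat a)
    -- the count and the excess
    (η := Sgn.η κ Φ) ?_ (Sgn₂.η_facts κ Φ).2.2.1 (Rex := Sgn₂.Rex κ Φ p O q) ?_ ?_
    -- the kit
    (Mz := Sgn.Mu O) (Sgn₂.mem_lists_at (κ := κ) (Φ := Φ) (p := p) (O := O)).1 (Sgn₂.Mu_facts hat).2.2.2 (ℓK := Skelφ.Prm.ℓK (Sgn.Mu O))
    (fun I _ => (Sgn₂.mem_lists_at (κ := κ) (Φ := Φ) (p := p) (O := O)).2.1) (fun I _ => (Sgn₂.mem_lists_at (κ := κ) (Φ := Φ) (p := p) (O := O)).2.2.1)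
    (A := Skelφ.Prm.A O.D (Sgn.Mu O)) (Rk := Skelφ.Prm.Rk O.D (Sgn.Mu O)) (Skelφ.Prm.hAw O.D (Sgn.Mu O)) (Skelφ.Prm.hRk O.D (Sgn.Mu O))
    (ℓs := Sgn.M O) (M := Sgn.M O) (K := Sgn.Kd O) (R'k := Sgn.Rseed Φ O) (r₀ := Sgn₂.r₀ κ Φ p O) (rs := Sgn.rs Φ O)
    (Skelφ.Prm.one_le_M O.D (Sgn.Mu O)) le_rfl (Skelφ.Prm.hA O.D (Sgn.Mu O)) (Skelφ.Prm.hAℓ O.D (Sgn.Mu O))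
    (Skelφ.Prm.hK O.D (Sgn.Mu O) (Sgn.ρz O)) (Skelφ.Prm.hnA O.D (Sgn.Mu O)) (Skelφ.Prm.hnM O.D (Sgn.Mu O)) ?_
    (Skelφ.Prm.hR'₁ O.D (Sgn.Mu O) G Φ.φ Φ.types) (Skelφ.Prm.hR'₂ O.D (Sgn.Mu O) G Φ.φ Φ.types) hr₀₁ hr₀₂
    (Skelφ.Prm.hrs₁ O.D (Sgn.Mu O) G Φ.φ Φ.types (Sgn.ρz O)) (Skelφ.Prm.hrs₂ O.D (Sgn.Mu O) G Φ.φ Φ.types (Sgn.ρz O))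
    (cU := Sgn.cU Φ O) (Skelφ.Prm.hcU O.D (Sgn.Mu O) Φ.Δ)
    -- the route rooms on the merged range
    (fun a => (Sgn₂.corr_route_at hat a).1)
    (fun a ℓ h₀ h₁ => ((Sgn₂.corr_route_at hat a).2.1 ℓ ((Sgn₂.corr_range_at hat a).1.trans h₀) (h₁.trans (Sgn₂.corr_range_at hat a).2.1)).1)
    (fun a ℓ h₀ h₁ => ((Sgn₂.corr_route_at hat a).2.1 ℓ ((Sgn₂.corr_range_at hat a).1.trans h₀) (h₁.trans (Sgn₂.corr_range_at hat a).2.1)).2)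
    (fun a a' I ℓ h₀ h₁ => Sgn₂.hdepth_range_at hat a' I ((Sgn₂.corr_range_at hat a).1.trans h₀) (h₁.trans (Sgn₂.corr_range_at hat a).2.1))
    (fun a ℓ h₀ _ => Sgn₂.corr_widths_merged_at hat (oth a) ((Sgn₂.corr_range_at hat a).2.2.trans ((Sgn₂.corr_range_at hat a).1.trans h₀)))
    (fun a ℓ h₀ _ => Sgn₂.corr_widths_merged_at hat a ((Sgn₂.corr_range_at hat a).2.2.trans ((Sgn₂.corr_range_at hat a).1.trans h₀)))
    (fun a ℓ h₀ _ => Sgn₂.corr_widths_merged_at hat a ((Sgn₂.corr_range_at hat a).2.2.trans ((Sgn₂.corr_range_at hat a).1.trans h₀)))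
    -- the depth budget and the kit number
    (Sgn₂.r₀_add_three_le_Lp hat) (Sgn₂.E₀_at hat).2.2 (Sgn.kP κ Φ p O) hNP hkP
  · -- `44·rmax + 3 ≤ E₀`
    have := (Sgn₂.E₀_at hat).1; omega
  · -- the count over the level window `[T₀, T₀ + Lcnt − 1]`
    rw [hcard]; exact hcnt _ le_rfl
  · -- the excess radius at planar diameter `50·rmax ≤ 60·rmax`
    intro R₀' R₁ hR Rw D' A' hD hbox hA' hA
    exact Sgn₂.hRex_at_le hat R₀' (m := 50 * (Sgn₂.cells κ Φ p O).rmax) (by omega) le_rfl t R₁ hR Rw D' A' hD hbox hA' hA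
  · -- the excess radius is synchronised with the radii
    intro g
    have := (Sgn₂.fibre_at (κ := κ) (Φ := Φ) (p := p) (O := O) (q := q) 0 g).2.2.2.2.1
    omega
  · -- the zone room of the kit: `ψ Mu + off = ρz`
    intro i
    have := Skelφ.Prm.hρK O.D (Sgn.Mu O) (Sgn.ρz O) i
    rw [← hRΛ.1]
    exact this

end PlanarSkeletonSign

end Summit.CriticalPhenomena.PercolationContinuityZ3.Theorems.Transplant

end
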